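import Summits.BirchSwinnertonDyer.Rank1Residual.Additive.QuadraticBranchEvenDefectCount
import Summits.BirchSwinnertonDyer.Rank1Residual.Additive.LocalPreimageCardSignedTwist
import Summits.BirchSwinnertonDyer.Rank1Residual.Additive.QuadraticBranchEvenControlLower
import HarnessLib

/-!
# T-e2-r0 ON EVERY ROW: `#A₀⁺ = #Sel_{p^∞}(W/ℚ) · ∏_{ℓ ∈ T} p^{ord_p c_ℓ(W)}` and the typed node
# `QuadraticBranchEvenExactControlOfPlusMCAt W p` from (R1⁺) + (R2⁺) + `hPT`, Tamagawa defect INCLUDED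
(cell `bsd-potss`, seat `bsd-potss-ctrl` g2; R-ctrl-17 = K8 crux `ExactControlEven`, brick 3 — the
even twin of x1b's `QuadraticBranchOddStrictExactControlDischarge` / file 121)

HONEST FRAMING (cell `bsd-potss`, run/shared/lean/pub/bsd-potss/; FULL-BSD rank ≤ 1 programme,
tranche 1b): TOOL THEOREMS ONLY — no definition, no named Literature fact introduced, no `sorry`, axioms
standard. CONDITIONAL exactly on: the NAMED FACT `poitouTate_selmerStructure_duality_real ℚ` (`hPT`,
Milne I 4.10 with the real place, as in x1b's series) and — §2 only — the cell's TYPED READINGS (R1⁺)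
`EvenBranchPlusCharIdealOfPlusMCAt` (now a THEOREM from the K8 crux `EtaTransportSigned`,
`SignedTwist.evenBranchPlusCharIdealOfPlusMCAt_of_plusMCEta`) and (R2⁺) `EvenBranchPlusNoFiniteSubmoduleAt`.
(L0⁺) is a theorem and is consumed as such. Nothing is booked; no label / mark / count moves; (C1_η) is
a hypothesis INSIDE the node; nothing about `BSD(W, p)` is claimed.

## What
* §1 `card_localPreimage_one_eq_card_selmer_mul_prod_of_quadraticTwist_signedPrime` — for the
  `p*`-twist `W` of a globally minimal good `a_p = 0` curve (`p` odd, `κ` cyclotomic), GIVEN `hPT`,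
  `A₀⁺ = Sel^{loc,∞,+}(W/ℚ)` FINITE, and a finite `T ∌ (p)` containing every `ℓ ≠ p` with `p ∣ c_ℓ(W)`:
  **`#A₀⁺ = #Sel_{p^∞}(W/ℚ) · ∏_{ℓ ∈ T} p^{ord_p c_ℓ(W)}`** — brick 2 at the level
  `m = 2a + ∑ s_ℓ + ∑ ord_p c_ℓ + 1` (`#A₀⁺ = p^a`; `e = a` kills `Sel⁺(W/ℚ_0) ≤ A₀⁺`; (kill) by x1b file
  109), the local factors `[𝓣_ℓ : 𝓚_ℓ] = p^{ord_p c_ℓ}` by x1b file 75 (B4, cyclotomic), Lagrange, and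
  `#Sel⁺(W/ℚ_0) = #Sel_{p^∞}(W/ℚ)` (this seat's file 1). NO Mordell–Weil input, NO `Ш`-exponent.
* §2 **`quadraticBranchEvenExactControlOfPlusMCAt_of_readings (hPT) (hR1) (hR2) :
  QuadraticBranchEvenExactControlOfPlusMCAt W p`** — B. D. Kim's formula at `η` on EVERY Gss2 rank-0 row
  `p ≥ 5`, Tamagawa defect included (this seat's `…_of_readings_of_not_dvd_tamagawa` had `p ∤ Tam(W)`):
  file 1's `#A₀⁺ = p^{v_p L(0)}` under (R1⁺)+(R2⁺), §1, `∑_T ord_p c_ℓ = ord_p Tam(W)` (`c_p(W) ≤ 4 < p`),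
  `p ∤ #W(ℚ)_tors`.

References: [Kobayashi2003] Thm. 9.3 with (9.33) (pp. 26–27), §4 (p. 8); [GreenbergLNM1716] §3 Lemma
3.1–3.3, §4 Thm. 4.1, Lemma 4.2 (p. 102); [MilneADT2006] I Thm. 4.10; [BDKim2013] Thm. 1.1 (shape).
-/

noncomputable section

open scoped Classical MatrixGroups ModularForm

open CongruenceSubgroup CategoryTheory Field Function NumberField IsDedekindDomain WeierstrassCurve
open Literature.NumberTheory.EllipticCurves
open Literature.NumberTheory.EllipticCurves.ModularForms
open Literature.NumberTheory.GaloisRepresentations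
open Literature.NumberTheory.GaloisRepresentations.DiscreteGaloisModule (SelmerStructure)
open Literature.NumberTheory.GaloisCohomology
open Literature.NumberTheory.EllipticCurves.Kobayashi2003
open Literature.NumberTheory.EllipticCurves.Rank1Residual
open Literature.NumberTheory.EllipticCurves.IwasawaAlgebra
open Literature.NumberTheory.EllipticCurves.IwasawaDual
open Summit.BirchSwinnertonDyer.Rank1Residual.X11b.Levels
open Summit.BirchSwinnertonDyer.Rank1Residual.X11b
open Summit.BirchSwinnertonDyer.Rank1Residual.Additive.LevelBridge
open scoped ContRepresentation

namespace Summit.BirchSwinnertonDyer.Rank1Residual.Additive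

/-! ## §1 `#A₀⁺ = #Sel_{p^∞}(W/ℚ) · ∏_{ℓ ∈ T} p^{ord_p c_ℓ(W)}` -/

namespace RankZeroCount

variable {p : ℕ} [hp : Fact p.Prime] (κ : ZpExtension ℚ p) (W : WeierstrassCurve ℚ) [W.IsElliptic]
  [W.IsGloballyMinimal]

/-- **`#A₀⁺ = #Sel_{p^∞}(W/ℚ) · ∏_{ℓ ∈ T} p^{ord_p c_ℓ(W)}` — the even defect count in closed form.** See
the module docstring (§1). CONDITIONAL on `hPT`; nothing booked.
[cite: GreenbergLNM1716, §3 Lemma 3.1–3.3 (pp. 85–90), §4 Thm. 4.1] [cite: Kobayashi2003, Thm. 9.3 with (9.33) (pp. 26–27)]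
[cite: MilneADT2006, Ch. I, Thm. 4.10] -/
theorem card_localPreimage_one_eq_card_selmer_mul_prod_of_quadraticTwist_signedPrime
    (hp2 : p ≠ 2) (hκ : κ.IsCyclotomic) (Cv : VariableChange ℚ) (V : WeierstrassCurve ℚ) [V.IsElliptic]
    [V.IsGloballyMinimal] (hCV : Cv • W.quadraticTwist ((-1) ^ (p / 2) * p) = V)
    (hgood : V.HasGoodReductionAtPrime p) (hap : V.frobeniusTrace p = 0)
    (hPT : poitouTate_selmerStructure_duality_real ℚ)
    [hAfin : Finite ↥((W.selmerInfty κ ⊓ ⨅ σ : absoluteGaloisGroup ℚ,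
        (localKummerOverOfEmb W p κ.kerSubgroup (closureEmb (K := ℚ) ℚ_[p])
          (⨆ n, strictSignedLocalPoints κ ℚ_[p] W 1 n)).comap
            (W.conjH1 p κ.kerSubgroup σ)).comap (W.layerToInfty κ 0))]
    (T : Finset (HeightOneSpectrum (𝓞 ℚ)))
    (hpT : (Rat.HeightOneSpectrum.primesEquiv (R := 𝓞 ℚ)).symm ⟨p, hp.out⟩ ∉ T)
    (hT : ∀ v : HeightOneSpectrum (𝓞 ℚ), v ≠ (Rat.HeightOneSpectrum.primesEquiv (R := 𝓞 ℚ)).symm ⟨p, hp.out⟩ →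
      p ∣ (W.baseChange (v.adicCompletion ℚ)).localTamagawaNumber (v.adicCompletionIntegers ℚ) → v ∈ T) :
    Nat.card ↥((W.selmerInfty κ ⊓ ⨅ σ : absoluteGaloisGroup ℚ,
        (localKummerOverOfEmb W p κ.kerSubgroup (closureEmb (K := ℚ) ℚ_[p])
          (⨆ n, strictSignedLocalPoints κ ℚ_[p] W 1 n)).comap
            (W.conjH1 p κ.kerSubgroup σ)).comap (W.layerToInfty κ 0)) =
      Nat.card ↥(W.selmerGroupPInfty p) *
        ∏ w ∈ T, p ^ padicValNat p ((W.baseChange (w.adicCompletion ℚ)).localTamagawaNumber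
          (w.adicCompletionIntegers ℚ)) := by
  set v₀ := (Rat.HeightOneSpectrum.primesEquiv (R := 𝓞 ℚ)).symm ⟨p, hp.out⟩ with hv₀def
  set A := (W.selmerInfty κ ⊓ ⨅ σ : absoluteGaloisGroup ℚ,
      (localKummerOverOfEmb W p κ.kerSubgroup (closureEmb (K := ℚ) ℚ_[p])
        (⨆ n, strictSignedLocalPoints κ ℚ_[p] W 1 n)).comap
          (W.conjH1 p κ.kerSubgroup σ)).comap (W.layerToInfty κ 0) with hAdef
  set S0 := strictSignedSelmerLayer W κ ℚ_[p] 1 0 with hS0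
  -- `#A₀ = p^a`
  have hprim : ∀ y : A, ∃ k : ℕ, p ^ k • y = 0 := fun y ↦ by
    obtain ⟨k, hk⟩ := W.exists_pow_smul_subgroupH1_layer_eq_zero κ 0 (y : W.subgroupH1 p (κ.layerSubgroup 0))
    exact ⟨k, Subtype.ext (by rw [AddSubgroupClass.coe_nsmul, hk, ZeroMemClass.coe_zero])⟩
  obtain ⟨a, ha⟩ : ∃ a : ℕ, Nat.card A = p ^ a := by
    have hG : IsPGroup p (Multiplicative A) := fun x ↦ by
      obtain ⟨k, hk⟩ := hprim (Multiplicative.toAdd x)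
      refine ⟨k, ?_⟩
      apply Multiplicative.toAdd.injective
      rw [toAdd_pow, toAdd_one]
      exact hk
    obtain ⟨a, ha⟩ := IsPGroup.iff_card.mp hG
    exact ⟨a, by rw [← ha]; exact (Nat.card_congr Multiplicative.toAdd).symm⟩
  -- places: `p ∈ w ↔ w = v₀`
  have hpw : ∀ w : HeightOneSpectrum (𝓞 ℚ), w ≠ v₀ → (p : 𝓞 ℚ) ∉ w.asIdeal := fun w hw h ↦
    hw ((natCast_mem_asIdeal_iff_eq_primesEquiv_symm w hp.out).mp h)
  have hpT' : ∀ w ∈ T, (p : 𝓞 ℚ) ∉ w.asIdeal := fun w hw ↦ hpw w fun h ↦ hpT (h ▸ hw)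
  -- (kill): the bounds `s_w` (x1b file 109 §1)
  have hkill0 : ∀ w : HeightOneSpectrum (𝓞 ℚ), ∃ s : ℕ, (p : 𝓞 ℚ) ∉ w.asIdeal →
      ∀ m k : ℕ, s ≤ k → ∀ x ∈ W.kummerSelmerStructure ((p ^ m : ℕ) : ℤ) (Sum.inr w), p ^ k • x = 0 := by
    intro w
    by_cases h : (p : 𝓞 ℚ) ∈ w.asIdeal
    · exact ⟨0, fun h' ↦ absurd h h'⟩
    · obtain ⟨s, hs⟩ := exists_pow_smul_kummerSelmerStructure_inr_eq_zero W h
      exact ⟨s, fun _ ↦ hs⟩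
  choose s hs using hkill0
  -- `S₀ ≤ A₀`, hence `p^a` kills `S₀`
  obtain ⟨M, hΔ, hA, hVM⟩ := exists_goodSupersingularPadicModel hp2 V hgood hap
  obtain ⟨S, hS⟩ := exists_finset_forall_not_mem_good W p
  have hc := sq_ne_neg_one_pow_mul_prime hp.out (p / 2)
  have htors := eq_zero_of_prime_pow_smul_eq_zero_localFixedPointsOfEmb_kerSubgroup_of_quadraticTwist κ
    (closureEmb (K := ℚ) ℚ_[p]) hp2 W hc Cv hCV M hΔ hA hVM
  have hle : S0 ≤ A := by
    rw [hAdef, ← comap_layerToInfty_zero_strictSignedSelmerInfty_eq W κ ℚ_[p] 1 S hS htors]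
    intro y hy
    rw [AddSubgroup.mem_comap]
    exact map_layerToInfty_strictSignedSelmerLayer_le W κ ℚ_[p] 1 0 ⟨y, hy, rfl⟩
  have hSel : ∀ y ∈ S0, p ^ a • y = 0 := fun y hy ↦
    KummerLevelStabilisation.nsmul_eq_zero_of_natCard_dvd A (by rw [ha]) (hle hy)
  -- the local Tamagawa exponents and the level `m`
  obtain ⟨c, hc'⟩ : ∃ c : HeightOneSpectrum (𝓞 ℚ) → ℕ, ∀ w, c w =
      padicValNat p ((W.baseChange (w.adicCompletion ℚ)).localTamagawaNumber (w.adicCompletionIntegers ℚ)) :=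
    ⟨_, fun _ ↦ rfl⟩
  have hcle : ∀ w ∈ T, c w ≤ ∑ w ∈ T, c w := fun w hw ↦
    Finset.single_le_sum (fun _ _ ↦ Nat.zero_le _) hw
  have hsle : ∀ w ∈ T, s w ≤ ∑ w ∈ T, s w := fun w hw ↦
    Finset.single_le_sum (fun _ _ ↦ Nat.zero_le _) hw
  obtain ⟨m, hm⟩ : ∃ m : ℕ, m = a + a + (∑ w ∈ T, s w) + (∑ w ∈ T, c w) + 1 := ⟨_, rfl⟩
  -- the tower structure `𝓣` on `W[p^m]`, as an explicit term
  let 𝓣 : SelmerStructure (W.torsionGaloisModule ((p ^ m : ℕ) : ℤ)) := fun v ↦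
    match v with
    | Sum.inl w => W.kummerSelmerStructure ((p ^ m : ℕ) : ℤ) (Sum.inl w)
    | Sum.inr v => (W.localTowerKer κ (v.adicCompletion ℚ) 0).comap
        ((resH1Hom (Literature.NumberTheory.EllipticCurves.subgroupIncl
            (localSubgroup (κ.layerSubgroup 0) (v.adicCompletion ℚ)))
          (AddMonoidHom.id (localPoints W (v.adicCompletion ℚ))) (fun _ _ ↦ rfl)).comp
          (galoisCohomology.map
            (W.torsionPointsMapIntertwining ((p ^ m : ℕ) : ℤ) (v.adicCompletion ℚ)) 1))
  have h𝓣fin : ∀ v : HeightOneSpectrum (𝓞 ℚ), 𝓣 (Sum.inr v) =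
      (W.localTowerKer κ (v.adicCompletion ℚ) 0).comap
        ((resH1Hom (Literature.NumberTheory.EllipticCurves.subgroupIncl
            (localSubgroup (κ.layerSubgroup 0) (v.adicCompletion ℚ)))
          (AddMonoidHom.id (localPoints W (v.adicCompletion ℚ))) (fun _ _ ↦ rfl)).comp
          (galoisCohomology.map
            (W.torsionPointsMapIntertwining ((p ^ m : ℕ) : ℤ) (v.adicCompletion ℚ)) 1)) := fun _ ↦ rfl
  have h𝓣inf : ∀ w : InfinitePlace ℚ, 𝓣 (Sum.inl w) = W.kummerSelmerStructure ((p ^ m : ℕ) : ℤ) (Sum.inl w) :=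
    fun _ ↦ rfl
  -- brick 2 at the level `m`
  have hC := relIndex_strictSignedSelmerLayer_one_localPreimage_eq_prod W p κ m (by omega) hp2 hκ Cv V hCV
    hgood hap hPT v₀ rfl T hpT 𝓣 h𝓣fin h𝓣inf
    (fun v hv hne ↦ localTowerKerPrimary_eq_bot_of_not_dvd_localTamagawaNumber W hκ (hpw v hne)
      fun hd ↦ hv (hT v hne hd))
    (a := a) (e := a) (by rw [← hAdef, ha]) (by omega) hSel (by omega)
    (fun w hw x hx ↦ hs w (hpT' w hw) m _ ((hsle w hw).trans (by omega)) x hx)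
  -- the local factors (x1b file 75, B4)
  have hloc : ∀ w ∈ T, (W.kummerSelmerStructure ((p ^ m : ℕ) : ℤ) (Sum.inr w)).relIndex (𝓣 (Sum.inr w)) =
      p ^ padicValNat p ((W.baseChange (w.adicCompletion ℚ)).localTamagawaNumber
        (w.adicCompletionIntegers ℚ)) := fun w hw ↦ by
    obtain ⟨δ, hδ⟩ := Greenberg1999.exists_apply_resGal_ne_one_of_isCyclotomic hκ w
    exact relIndex_kummer_comap_localTowerKer_eq_pow_padicValNat_localTamagawaNumber W p κ m (hpT' w hw)
      ⟨δ, fun h ↦ hδ (ZpExtension.mem_kerSubgroup.mp h)⟩ ((hc' w) ▸ (hcle w hw).trans (by omega))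
  rw [Finset.prod_congr rfl hloc] at hC
  -- Lagrange: `#A₀ = [A₀ : S₀] · #S₀`, and `#S₀ = #Sel_{p^∞}(W/ℚ)`
  have hcardS : Nat.card (S0.addSubgroupOf A) = Nat.card S0 :=
    Nat.card_congr (AddSubgroup.addSubgroupOfEquivOfLe hle).toEquiv
  have hmul : Nat.card A = Nat.card (A ⧸ S0.addSubgroupOf A) * Nat.card S0 := by
    rw [AddSubgroup.card_eq_card_quotient_mul_card_addSubgroup (S0.addSubgroupOf A), hcardS]
  have hrel : Nat.card (A ⧸ S0.addSubgroupOf A) = S0.relIndex A := rfl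
  rw [hmul, hrel, hS0, hAdef, hC,
    StrictSignedLayerZero.natCard_strictSignedSelmerLayer_one_zero_eq_selmerGroupPInfty W κ]
  ring

end RankZeroCount

/-! ## §2 The typed node on every row -/

namespace EvenControlZero

variable (W : WeierstrassCurve ℚ) [W.IsElliptic] [W.IsGloballyMinimal] (p : ℕ) [hp : Fact p.Prime]

/-- **T-e2-r0 — the typed node `QuadraticBranchEvenExactControlOfPlusMCAt W p` — on EVERY Gss2 rank-0
row `p ≥ 5`, Tamagawa defect included, from `hPT` + (R1⁺) + (R2⁺).** For the good `a_p = 0` twin `V`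
with (C1_η), its newform, period ratio `ϖ`, any plus branch function `L` with `L(0) ≠ 0`:
`Sel_{p^∞}(W/ℚ)` is finite and **`ord_p #Sel_{p^∞}(W/ℚ) + ord_p(Tam(W)/#W(ℚ)_tors²) = v_p(L(0))`** — the
cyclotomic `κ`, `γ`, a plus dual datum `D` exist; (R1⁺) reads (C1_η) on `D`, (R2⁺) gives `hnf`; file 1:
`#A₀⁺ = p^{v_p L(0)}`; §1: `#A₀⁺ = #Sel · ∏_T p^{ord c_ℓ}`; `∑_T ord c_ℓ = ord_p Tam(W)`
(`ord_p c_p(W) = 0` for `p ≥ 5`), `p ∤ #W(ℚ)_tors`. CONDITIONAL on `hPT` and the two readings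
((C1_η) is INSIDE the node); nothing booked; the K8 crux `ExactControlEven` becomes a by-name
consequence of `EtaTransportSigned` + `NoFiniteSubmoduleSigned` + `hPT`.
[cite: Kobayashi2003, §4 (p. 8), Thm. 9.3 with (9.33) (pp. 26–27)] [cite: KitajimaOtsuki2018, Main Thm. 1.3 (arXiv:1607.03612 p. 3)]
[cite: GreenbergLNM1716, §3 Lemma 3.3, §4 Thm. 4.1 and Lemma 4.2 (p. 102)] [cite: MilneADT2006, Ch. I, Thm. 4.10] -/
theorem quadraticBranchEvenExactControlOfPlusMCAt_of_readings
    (hPT : poitouTate_selmerStructure_duality_real ℚ)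
    (hR1 : EvenBranchPlusCharIdealOfPlusMCAt W p) (hR2 : EvenBranchPlusNoFiniteSubmoduleAt W p) :
    QuadraticBranchEvenExactControlOfPlusMCAt W p := by
  intro V _ _ C N _ f hp5 hCV hgood hap h1 hf ϖ hϖ L hL h0
  have hp2 : p ≠ 2 := by omega
  set v₀ := (Rat.HeightOneSpectrum.primesEquiv (R := 𝓞 ℚ)).symm ⟨p, hp.out⟩ with hv₀
  -- the cyclotomic `ℤ_p`-extension, a normalised topological generator, a plus dual datum
  obtain ⟨γ, hγ, hχ⟩ := CyclotomicZp.exists_isTopGenerator_zpExtension p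
  have hκ := CyclotomicZp.isCyclotomic_zpExtension p
  have hγc : IsCyclotomicVariable p γ := ⟨1, IsOfFinOrder.one, by rw [mul_one]; exact hχ⟩
  obtain ⟨D⟩ := nonempty_strictSignedSelmerDualData W (CyclotomicZp.zpExtension p) ℚ_[p] 1 hγ
  -- (R1⁺), (R2⁺)
  obtain ⟨hfg, htor, hchar⟩ := hR1 V C hp2 hCV hgood hap h1 hf ϖ hϖ L hL _ γ hκ hγ hγc D
  haveI := hfg
  have hnf := hR2 V C hp2 hCV hgood hap _ γ hκ hγ D hfg htor
  -- file 1: `Sel` finite and `#A₀⁺ = p^{v_p L(0)}`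
  obtain ⟨hfinSel, -, -, hA⟩ :=
    finite_and_padicValNat_card_selmerGroupPInfty_add_eq_of_quadraticTwist_signedPrime W
      (CyclotomicZp.zpExtension p) hp2 C V hCV hgood hap hγ D htor hnf hchar h0
  haveI hfinA : Finite (↥((W.selmerInfty (CyclotomicZp.zpExtension p) ⊓
      ⨅ σ : Field.absoluteGaloisGroup ℚ,
        (localKummerOverOfEmb W p (CyclotomicZp.zpExtension p).kerSubgroup (closureEmb (K := ℚ) ℚ_[p])
            (⨆ m, strictSignedLocalPoints (CyclotomicZp.zpExtension p) ℚ_[p] W 1 m)).comap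
          (W.conjH1 p (CyclotomicZp.zpExtension p).kerSubgroup σ)).comap
      (W.layerToInfty (CyclotomicZp.zpExtension p) 0))) :=
    Nat.finite_of_card_ne_zero (by rw [hA]; exact pow_ne_zero _ hp.out.ne_zero)
  -- the exceptional set `T` = the bad places `≠ v₀`
  obtain ⟨S, hS⟩ := exists_finset_forall_not_mem_good W p
  set T := S.filter (fun v ↦ (p : 𝓞 ℚ) ∉ v.asIdeal) with hT
  have hv₀p : (p : 𝓞 ℚ) ∈ v₀.asIdeal := (natCast_mem_asIdeal_iff_eq_primesEquiv_symm v₀ hp.out).mpr rfl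
  have hpT : v₀ ∉ T := fun h ↦ (Finset.mem_filter.mp h).2 hv₀p
  have hTmem : ∀ v : HeightOneSpectrum (𝓞 ℚ), v ≠ v₀ →
      p ∣ (W.baseChange (v.adicCompletion ℚ)).localTamagawaNumber (v.adicCompletionIntegers ℚ) → v ∈ T := by
    intro v hv hdvd
    refine Finset.mem_filter.mpr ⟨?_, fun hpv ↦ hv ((natCast_mem_asIdeal_iff_eq_primesEquiv_symm v hp.out).mp hpv)⟩
    by_contra hvS
    rw [W.localTamagawaNumber_eq_one_of_hasGoodReductionAt_holds v (hS v hvS).2] at hdvd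
    exact hp.out.one_lt.ne' (Nat.dvd_one.mp hdvd)
  -- §1
  have hcard := RankZeroCount.card_localPreimage_one_eq_card_selmer_mul_prod_of_quadraticTwist_signedPrime
    (CyclotomicZp.zpExtension p) W hp2 hκ C V hCV hgood hap hPT T hpT hTmem
  -- bookkeeping
  have hc0 := LevelBridge.padicValNat_localTamagawaNumber_eq_zero_of_quadraticTwist_signedPrime W p hp5 C V
    hCV hgood
  have hTamSum := LevelBridge.sum_padicValNat_localTamagawaNumber_eq_padicValNat_tamagawaProduct W p T hpT
    hTmem hc0
  have htors := eq_zero_of_prime_smul_eq_zero_padic_of_quadraticTwist_goodSupersingular hp2 W C V hCV hgood hap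
  have htors0 := LevelBridge.padicValNat_torsionOrder_eq_zero_of_noPTorsion W p htors
  have hTamQ : (W.tamagawaProduct : ℚ) ≠ 0 := by exact_mod_cast W.tamagawaProduct_pos_holds.ne'
  have htQ : (W.torsionOrder : ℚ) ≠ 0 := by exact_mod_cast W.torsionOrder_pos_holds.ne'
  have hrat : padicValRat p ((W.tamagawaProduct : ℚ) / (W.torsionOrder : ℚ) ^ 2) =
      (padicValNat p W.tamagawaProduct : ℤ) := by
    rw [padicValRat.div hTamQ (pow_ne_zero 2 htQ), padicValRat.pow, padicValRat.of_nat, padicValRat.of_nat,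
      htors0]
    simp
  refine ⟨hfinSel, ?_⟩
  -- numerics: `a = ord #Sel + ∑_T ord c_ℓ` from `p^a = #Sel · ∏ p^{ord c_ℓ}`
  haveI := hfinSel
  have hSel0 : Nat.card ↥(W.selmerGroupPInfty p) ≠ 0 := Nat.card_pos.ne'
  have hp0 : p ≠ 0 := hp.out.ne_zero
  rw [hA, Finset.prod_pow_eq_pow_sum, hTamSum] at hcard
  have hval := congrArg (padicValNat p) hcard
  rw [padicValNat.prime_pow, padicValNat.mul hSel0 (pow_ne_zero _ hp0), padicValNat.prime_pow] at hval
  have hv' : ((PowerSeries.constantCoeff L : ℤ_[p]) : ℚ_[p]).valuation =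
      ((((PowerSeries.constantCoeff L : ℤ_[p]) : ℚ_[p]).valuation).toNat : ℤ) :=
    (Int.toNat_of_nonneg (PadicInt.valuation_coe_nonneg)).symm
  rw [hrat, hv', hval]
  push_cast
  ring

end EvenControlZero

end Summit.BirchSwinnertonDyer.Rank1Residual.Additive

end
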